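import Mathlib
import HarnessLib

/-!
# Geometric block decompositions of `∑_{n ≤ N}` (bookkeeping for Patel–Yang §3.4–3.5)

Topic `Literature/NumberTheory/LFunctions`. Patel–Yang 2024, (3.4) and Lemmas 3.3/3.5: the range
`(a_K, a_0]` with `a_k = ⌊Y h^{-k}⌋` is split into the blocks `(a_{k+1}, a_k]`, each of ratio at most
`h(1 + 1/(Yh^{-K} - 1))`, and sums of powers `∑_k a_{k+1}^{x}` are bounded by geometric series
(`Y^x/(h^x - 1)` for `x > 0`, `(Yh^{-K} - 1)^x/(1 - h^x)` for `x < 0`). Everything is PROVED; this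
file is pure bookkeeping (no number theory).

## Main results

* `Literature.NumberTheory.LFunctions.VdC.geomBlock` — `a_k = ⌊Y/ρ^k⌋₊`.
* `Literature.NumberTheory.LFunctions.VdC.norm_sum_Ioc_telescope_le` — `‖∑_{u K<n≤u 0}‖ ≤ ∑_k ‖∑_{u(k+1)<n≤u k}‖`.
* `Literature.NumberTheory.LFunctions.VdC.geomBlock_ratio_le` — `a_k ≤ ρ(1 + 1/(y_K - 1)) a_{k+1}`.
* `Literature.NumberTheory.LFunctions.VdC.sum_geomBlock_rpow_le_of_pos` /`…_of_neg` — the geometric sums.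
* `Literature.NumberTheory.LFunctions.VdC.geomSeq_floorLog_ge` / `…_lt` — the choice `K = ⌊log(Y/Z)/log ρ⌋`.

## References

* D. Patel, A. Yang, *An explicit sub-Weyl bound for `ζ(1/2 + it)`*, J. Number Theory 262 (2024),
  (3.4) and the proofs of Lemmas 3.3, 3.5. [cite: PatelYang2024, Lemma 3.5]
-/

noncomputable section

open Real Set

namespace Literature.NumberTheory.LFunctions
namespace VdC

/-- The geometric sequence `y_k = Y/ρ^k`. [cite: PatelYang2024, (3.4)] -/
def geomSeq (Y ρ : ℝ) (k : ℕ) : ℝ := Y / ρ ^ k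

/-- The block boundaries `a_k = ⌊Y/ρ^k⌋₊`. [cite: PatelYang2024, (3.4)] -/
def geomBlock (Y ρ : ℝ) (k : ℕ) : ℕ := ⌊Y / ρ ^ k⌋₊

/-- `y_k = ρ y_{k+1}`. [folklore] -/
theorem geomSeq_succ {Y ρ : ℝ} (hρ : ρ ≠ 0) (k : ℕ) : geomSeq Y ρ k = ρ * geomSeq Y ρ (k + 1) := by
  unfold geomSeq; rw [pow_succ]; field_simp

/-- `y` is non-increasing (`ρ ≥ 1`, `Y ≥ 0`). [folklore] -/
theorem geomSeq_antitone {Y ρ : ℝ} (hY : 0 ≤ Y) (hρ : 1 ≤ ρ) {k l : ℕ} (hkl : k ≤ l) :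
    geomSeq Y ρ l ≤ geomSeq Y ρ k := by
  unfold geomSeq
  exact div_le_div_of_nonneg_left hY (by positivity) (pow_le_pow_right₀ hρ hkl)

/-- `a` is non-increasing. [folklore] -/
theorem geomBlock_antitone {Y ρ : ℝ} (hY : 0 ≤ Y) (hρ : 1 ≤ ρ) {k l : ℕ} (hkl : k ≤ l) :
    geomBlock Y ρ l ≤ geomBlock Y ρ k :=
  Nat.floor_mono (geomSeq_antitone hY hρ hkl)

/-- `y_k - 1 ≤ a_k ≤ y_k`. [folklore] -/
theorem geomBlock_le {Y ρ : ℝ} (hY : 0 ≤ Y) (hρ : 0 < ρ) (k : ℕ) :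
    (geomBlock Y ρ k : ℝ) ≤ geomSeq Y ρ k :=
  Nat.floor_le (by positivity)

/-- `y_k - 1 ≤ a_k`. [folklore] -/
theorem geomSeq_sub_one_le (Y ρ : ℝ) (k : ℕ) : geomSeq Y ρ k - 1 ≤ geomBlock Y ρ k := by
  unfold geomSeq geomBlock; linarith [Nat.lt_floor_add_one (Y / ρ ^ k)]

/-! ### Telescoping -/

/-- `∑_{u K < n ≤ u 0} = ∑_{k<K} ∑_{u(k+1) < n ≤ u k}` for a non-increasing `u`. [folklore] -/
theorem sum_Ioc_telescope {M : Type*} [AddCommMonoid M] (f : ℕ → M) {u : ℕ → ℕ}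
    (hu : ∀ k, u (k + 1) ≤ u k) (K : ℕ) :
    ∑ n ∈ Finset.Ioc (u K) (u 0), f n = ∑ k ∈ Finset.range K, ∑ n ∈ Finset.Ioc (u (k + 1)) (u k), f n := by
  have hmono : Antitone u := antitone_nat_of_succ_le hu
  induction K with
  | zero => simp
  | succ K ih =>
    rw [Finset.sum_range_succ, ← ih, add_comm (∑ n ∈ Finset.Ioc (u K) (u 0), f n),
      ← Finset.sum_union (Finset.Ioc_disjoint_Ioc_of_le le_rfl),
      Finset.Ioc_union_Ioc_eq_Ioc (hu K) (hmono (Nat.zero_le K))]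

/-- `‖∑_{u K < n ≤ u 0} f‖ ≤ ∑_{k<K} ‖∑_{u(k+1) < n ≤ u k} f‖`. [folklore] -/
theorem norm_sum_Ioc_telescope_le (f : ℕ → ℂ) {u : ℕ → ℕ} (hu : ∀ k, u (k + 1) ≤ u k) (K : ℕ) :
    ‖∑ n ∈ Finset.Ioc (u K) (u 0), f n‖
      ≤ ∑ k ∈ Finset.range K, ‖∑ n ∈ Finset.Ioc (u (k + 1)) (u k), f n‖ := by
  rw [sum_Ioc_telescope f hu K]; exact norm_sum_le _ _

/-- `∑_{n ≤ u 0} = ∑_{n ≤ u K} + ∑_{u K < n ≤ u 0}` in norm. [folklore] -/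
theorem norm_sum_Icc_split_le (f : ℕ → ℂ) {m N : ℕ} (hmN : m ≤ N) :
    ‖∑ n ∈ Finset.Icc 1 N, f n‖ ≤ ‖∑ n ∈ Finset.Icc 1 m, f n‖ + ‖∑ n ∈ Finset.Ioc m N, f n‖ := by
  have h : Finset.Icc 1 N = Finset.Icc 1 m ∪ Finset.Ioc m N := by
    ext n; simp only [Finset.mem_Icc, Finset.mem_union, Finset.mem_Ioc]; omega
  have hd : Disjoint (Finset.Icc 1 m) (Finset.Ioc m N) := by
    rw [Finset.disjoint_left]; intro n h1 h2
    simp only [Finset.mem_Icc] at h1; simp only [Finset.mem_Ioc] at h2; omega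
  rw [h, Finset.sum_union hd]; exact norm_add_le _ _

/-! ### Ratios and lower bounds of the blocks -/

/-- **Block ratio**: for `k < K` and `y_K > 1`, `a_k ≤ ρ(1 + 1/(y_K - 1)) a_{k+1}`. [cite: PatelYang2024, Lemma 3.5] -/
theorem geomBlock_ratio_le {Y ρ : ℝ} (hY : 0 ≤ Y) (hρ : 1 ≤ ρ) {K k : ℕ} (hk : k < K)
    (hyK : 1 < geomSeq Y ρ K) :
    (geomBlock Y ρ k : ℝ) ≤ ρ * (1 + 1 / (geomSeq Y ρ K - 1)) * geomBlock Y ρ (k + 1) := by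
  have hρ0 : 0 < ρ := by linarith
  have h1 : (geomBlock Y ρ k : ℝ) ≤ geomSeq Y ρ k := geomBlock_le hY hρ0 k
  have h2 : geomSeq Y ρ k = ρ * geomSeq Y ρ (k + 1) := geomSeq_succ hρ0.ne' k
  have h3 : geomSeq Y ρ (k + 1) - 1 ≤ geomBlock Y ρ (k + 1) := geomSeq_sub_one_le Y ρ (k + 1)
  have h4 : geomSeq Y ρ K ≤ geomSeq Y ρ (k + 1) := geomSeq_antitone hY hρ (by omega)
  have h5 : 0 < geomSeq Y ρ K - 1 := by linarith
  -- `y(k+1) ≤ u(k+1) (1 + 1/(y_K - 1))`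
  have h6 : geomSeq Y ρ (k + 1) ≤ (geomBlock Y ρ (k + 1) : ℝ) * (1 + 1 / (geomSeq Y ρ K - 1)) := by
    rw [mul_add, mul_one, mul_one_div]
    have h7 : 1 ≤ (geomBlock Y ρ (k + 1) : ℝ) / (geomSeq Y ρ K - 1) := by
      rw [le_div_iff₀ h5]; linarith
    linarith
  calc (geomBlock Y ρ k : ℝ) ≤ ρ * geomSeq Y ρ (k + 1) := by rw [← h2]; exact h1
    _ ≤ ρ * ((geomBlock Y ρ (k + 1) : ℝ) * (1 + 1 / (geomSeq Y ρ K - 1))) :=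
        mul_le_mul_of_nonneg_left h6 hρ0.le
    _ = ρ * (1 + 1 / (geomSeq Y ρ K - 1)) * geomBlock Y ρ (k + 1) := by ring

/-- **Block lower bound**: for `k < K`, `a_{k+1} ≥ y_K - 1`. [folklore] -/
theorem geomBlock_succ_ge {Y ρ : ℝ} (hY : 0 ≤ Y) (hρ : 1 ≤ ρ) {K k : ℕ} (hk : k < K) :
    geomSeq Y ρ K - 1 ≤ geomBlock Y ρ (k + 1) :=
  le_trans (by linarith [geomSeq_antitone hY hρ (show k + 1 ≤ K by omega)])
    (geomSeq_sub_one_le Y ρ (k + 1))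

/-! ### Geometric sums of powers of the block starts -/

/-- `∑_{k<K} r^{k+1} ≤ r/(1-r)` for `0 ≤ r < 1`. [folklore] -/
theorem sum_pow_succ_le {r : ℝ} (hr0 : 0 ≤ r) (hr1 : r < 1) (K : ℕ) :
    ∑ k ∈ Finset.range K, r ^ (k + 1) ≤ r / (1 - r) := by
  have h1 : ∑ k ∈ Finset.range K, r ^ (k + 1) = r * ∑ k ∈ Finset.range K, r ^ k := by
    rw [Finset.mul_sum]; refine Finset.sum_congr rfl fun k _ => ?_; ring
  rw [h1, geom_sum_eq hr1.ne, div_eq_mul_inv, div_eq_mul_inv]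
  have h2 : (r ^ K - 1) * (r - 1)⁻¹ ≤ (1 - r)⁻¹ := by
    rw [show (r - 1)⁻¹ = -(1 - r)⁻¹ by rw [← inv_neg, neg_sub]]
    have : 0 ≤ r ^ K := pow_nonneg hr0 K
    have h3 : 0 < (1 - r)⁻¹ := inv_pos.2 (by linarith)
    nlinarith
  exact mul_le_mul_of_nonneg_left h2 hr0

/-- `∑_{k<K} s^{k+1} ≤ s^K/(1 - s⁻¹)` for `s > 1`. [folklore] -/
theorem sum_pow_succ_le_of_one_lt {s : ℝ} (hs : 1 < s) (K : ℕ) :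
    ∑ k ∈ Finset.range K, s ^ (k + 1) ≤ s ^ K / (1 - s⁻¹) := by
  have hs0 : 0 < s := by linarith
  have h1 : ∑ k ∈ Finset.range K, s ^ (k + 1) = s * ∑ k ∈ Finset.range K, s ^ k := by
    rw [Finset.mul_sum]; refine Finset.sum_congr rfl fun k _ => ?_; ring
  rw [h1, geom_sum_eq hs.ne']
  have hs1 : (s - 1) ≠ 0 := by linarith
  calc s * ((s ^ K - 1) / (s - 1)) = (s ^ K * s - s) / (s - 1) := by field_simp
    _ ≤ (s ^ K * s) / (s - 1) := div_le_div_of_nonneg_right (by linarith) (by linarith)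
    _ = s ^ K / (1 - s⁻¹) := by field_simp

/-- **Positive powers**: for `x > 0`, `ρ > 1`, `Y ≥ 0`: `∑_{k<K} a_{k+1}^x ≤ Y^x/(ρ^x - 1)`.
[cite: PatelYang2024, Lemma 3.5] -/
theorem sum_geomBlock_rpow_le_of_pos {Y ρ x : ℝ} (hY : 0 ≤ Y) (hρ : 1 < ρ) (hx : 0 < x) (K : ℕ) :
    ∑ k ∈ Finset.range K, (geomBlock Y ρ (k + 1) : ℝ) ^ x ≤ Y ^ x / (ρ ^ x - 1) := by
  have hρ0 : 0 < ρ := by linarith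
  set r : ℝ := (ρ ^ x)⁻¹ with hr
  have hρx : 1 < ρ ^ x := Real.one_lt_rpow hρ hx
  have hr0 : 0 ≤ r := by positivity
  have hr1 : r < 1 := inv_lt_one_of_one_lt₀ hρx
  have hterm : ∀ k ∈ Finset.range K, (geomBlock Y ρ (k + 1) : ℝ) ^ x ≤ Y ^ x * r ^ (k + 1) := by
    intro k _
    calc (geomBlock Y ρ (k + 1) : ℝ) ^ x ≤ (geomSeq Y ρ (k + 1)) ^ x :=
          Real.rpow_le_rpow (Nat.cast_nonneg _) (geomBlock_le hY hρ0 _) hx.le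
      _ = Y ^ x * r ^ (k + 1) := by
          unfold geomSeq
          have e : (ρ ^ (k + 1)) ^ x = (ρ ^ x) ^ (k + 1) := by
            rw [← Real.rpow_natCast ρ (k + 1), ← Real.rpow_mul hρ0.le, ← Real.rpow_natCast (ρ ^ x) (k + 1),
              ← Real.rpow_mul hρ0.le, mul_comm]
          rw [Real.div_rpow hY (by positivity), e, hr, inv_pow, div_eq_mul_inv]
  refine (Finset.sum_le_sum hterm).trans ?_
  rw [← Finset.mul_sum]
  calc Y ^ x * ∑ k ∈ Finset.range K, r ^ (k + 1) ≤ Y ^ x * (r / (1 - r)) :=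
        mul_le_mul_of_nonneg_left (sum_pow_succ_le hr0 hr1 K) (by positivity)
    _ = Y ^ x / (ρ ^ x - 1) := by
        rw [hr]
        have : ρ ^ x - 1 ≠ 0 := by linarith
        field_simp

/-- **Negative powers**: for `x < 0`, `ρ > 1`, `Y ≥ 0` and `y_K > 1`:
`∑_{k<K} a_{k+1}^x ≤ (y_K - 1)^x/(1 - ρ^x)`. [cite: PatelYang2024, Lemma 3.5] -/
theorem sum_geomBlock_rpow_le_of_neg {Y ρ x : ℝ} (hY : 0 ≤ Y) (hρ : 1 < ρ) (hx : x < 0) {K : ℕ}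
    (hyK : 1 < geomSeq Y ρ K) :
    ∑ k ∈ Finset.range K, (geomBlock Y ρ (k + 1) : ℝ) ^ x ≤ (geomSeq Y ρ K - 1) ^ x / (1 - ρ ^ x) := by
  have hρ0 : 0 < ρ := by linarith
  have hyK0 : 0 < geomSeq Y ρ K := by linarith
  have hY0 : 0 < Y := by
    unfold geomSeq at hyK0
    by_contra h
    have : Y = 0 := le_antisymm (not_lt.1 h) hY
    rw [this, zero_div] at hyK0; exact lt_irrefl _ hyK0
  set c : ℝ := 1 - 1 / geomSeq Y ρ K with hc
  have hc0 : 0 < c := by rw [hc, sub_pos, div_lt_one hyK0]; exact hyK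
  have hc1 : c * geomSeq Y ρ K = geomSeq Y ρ K - 1 := by rw [hc]; field_simp
  set s : ℝ := ρ ^ (-x) with hs
  have hs1 : 1 < s := Real.one_lt_rpow hρ (by linarith)
  have hs0 : 0 < s := by linarith
  -- each term
  have hterm : ∀ k ∈ Finset.range K, (geomBlock Y ρ (k + 1) : ℝ) ^ x ≤ (c * Y) ^ x * s ^ (k + 1) := by
    intro k hk
    rw [Finset.mem_range] at hk
    have hyk : geomSeq Y ρ K ≤ geomSeq Y ρ (k + 1) := geomSeq_antitone hY hρ.le (by omega)
    have hlow : c * geomSeq Y ρ (k + 1) ≤ geomBlock Y ρ (k + 1) := by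
      have h1 := geomSeq_sub_one_le Y ρ (k + 1)
      have h2 : c * geomSeq Y ρ (k + 1) = geomSeq Y ρ (k + 1) - geomSeq Y ρ (k + 1) / geomSeq Y ρ K := by
        rw [hc]; ring
      have h3 : 1 ≤ geomSeq Y ρ (k + 1) / geomSeq Y ρ K := by rw [one_le_div hyK0]; exact hyk
      linarith
    have hpos : 0 < c * geomSeq Y ρ (k + 1) := mul_pos hc0 (hyK0.trans_le hyk)
    calc (geomBlock Y ρ (k + 1) : ℝ) ^ x ≤ (c * geomSeq Y ρ (k + 1)) ^ x :=
          Real.rpow_le_rpow_of_nonpos hpos hlow hx.le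
      _ = (c * Y) ^ x * s ^ (k + 1) := by
          unfold geomSeq
          rw [mul_div_assoc', Real.div_rpow (by positivity) (by positivity), hs, ← Real.rpow_natCast,
            ← Real.rpow_mul hρ0.le, ← Real.rpow_natCast, ← Real.rpow_mul hρ0.le, div_eq_mul_inv,
            ← Real.rpow_neg hρ0.le]
          congr 2; ring
  refine (Finset.sum_le_sum hterm).trans ?_
  rw [← Finset.mul_sum]
  have hsum := sum_pow_succ_le_of_one_lt hs1 K
  calc (c * Y) ^ x * ∑ k ∈ Finset.range K, s ^ (k + 1) ≤ (c * Y) ^ x * (s ^ K / (1 - s⁻¹)) :=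
        mul_le_mul_of_nonneg_left hsum (by positivity)
    _ = (geomSeq Y ρ K - 1) ^ x / (1 - ρ ^ x) := by
        have e1 : s⁻¹ = ρ ^ x := by rw [hs, Real.rpow_neg hρ0.le, inv_inv]
        have e2 : s ^ K = ((ρ ^ K) ^ x)⁻¹ := by
          rw [hs, ← Real.rpow_natCast, ← Real.rpow_mul hρ0.le, ← Real.rpow_natCast ρ K,
            ← Real.rpow_mul hρ0.le, show (-x) * (K : ℝ) = -((K : ℝ) * x) by ring, Real.rpow_neg hρ0.le]
        have e3 : (geomSeq Y ρ K - 1) ^ x = (c * Y) ^ x / (ρ ^ K) ^ x := by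
          rw [← hc1]; unfold geomSeq; rw [mul_div_assoc', Real.div_rpow (by positivity) (by positivity)]
        have hne : (ρ ^ K) ^ x ≠ 0 := (Real.rpow_pos_of_pos (by positivity) _).ne'
        have hne2 : 1 - ρ ^ x ≠ 0 := by
          have : ρ ^ x < 1 := Real.rpow_lt_one_of_one_lt_of_neg hρ hx
          linarith
        rw [e1, e2, e3]
        field_simp

/-! ### Choosing the number of blocks -/

/-- With `K = ⌊log(Y/Z)/log ρ⌋₊` (`Y ≥ Z > 0`, `ρ > 1`): `y_K ≥ Z`. [folklore] -/
theorem geomSeq_floorLog_ge {Y Z ρ : ℝ} (hZ : 0 < Z) (hYZ : Z ≤ Y) (hρ : 1 < ρ) :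
    Z ≤ geomSeq Y ρ ⌊Real.log (Y / Z) / Real.log ρ⌋₊ := by
  have hρ0 : 0 < ρ := by linarith
  have hY0 : 0 < Y := hZ.trans_le hYZ
  have hlog : 0 < Real.log ρ := Real.log_pos hρ
  have hYZ0 : 0 ≤ Real.log (Y / Z) / Real.log ρ :=
    div_nonneg (Real.log_nonneg (by rw [le_div_iff₀ hZ]; linarith)) hlog.le
  set K := ⌊Real.log (Y / Z) / Real.log ρ⌋₊ with hK
  have h1 : (K : ℝ) ≤ Real.log (Y / Z) / Real.log ρ := Nat.floor_le hYZ0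
  have h2 : ρ ^ K ≤ Y / Z := by
    have h3 : Real.log (ρ ^ K) ≤ Real.log (Y / Z) := by
      rw [Real.log_pow]; rwa [le_div_iff₀ hlog] at h1
    exact (Real.log_le_log_iff (by positivity) (by positivity)).1 h3
  unfold geomSeq
  rw [le_div_iff₀ (by positivity)]
  calc Z * ρ ^ K ≤ Z * (Y / Z) := mul_le_mul_of_nonneg_left h2 hZ.le
    _ = Y := by field_simp

/-- With `K = ⌊log(Y/Z)/log ρ⌋₊`: `y_K < ρ Z`. [folklore] -/
theorem geomSeq_floorLog_lt {Y Z ρ : ℝ} (hZ : 0 < Z) (hYZ : Z ≤ Y) (hρ : 1 < ρ) :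
    geomSeq Y ρ ⌊Real.log (Y / Z) / Real.log ρ⌋₊ < ρ * Z := by
  have hρ0 : 0 < ρ := by linarith
  have hY0 : 0 < Y := hZ.trans_le hYZ
  have hlog : 0 < Real.log ρ := Real.log_pos hρ
  set K := ⌊Real.log (Y / Z) / Real.log ρ⌋₊ with hK
  have h1 : Real.log (Y / Z) / Real.log ρ < K + 1 := Nat.lt_floor_add_one _
  have h2 : Y / Z < ρ ^ (K + 1) := by
    have h3 : Real.log (Y / Z) < Real.log (ρ ^ (K + 1)) := by
      rw [Real.log_pow]; push_cast; rwa [div_lt_iff₀ hlog] at h1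
    exact (Real.log_lt_log_iff (by positivity) (by positivity)).1 h3
  have h4 : Y < ρ ^ (K + 1) * Z := (div_lt_iff₀ hZ).1 h2
  unfold geomSeq
  rw [div_lt_iff₀ (by positivity)]
  rw [pow_succ] at h4
  nlinarith

/-- With `K = ⌈log(Y/Z)/log ρ⌉₊` (`Y, Z > 0`, `ρ > 1`): `y_K ≤ Z`. [folklore] -/
theorem geomSeq_ceilLog_le {Y Z ρ : ℝ} (hY : 0 < Y) (hZ : 0 < Z) (hρ : 1 < ρ) :
    geomSeq Y ρ ⌈Real.log (Y / Z) / Real.log ρ⌉₊ ≤ Z := by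
  have hρ0 : 0 < ρ := by linarith
  have hlog : 0 < Real.log ρ := Real.log_pos hρ
  set K := ⌈Real.log (Y / Z) / Real.log ρ⌉₊ with hK
  have h1 : Real.log (Y / Z) / Real.log ρ ≤ K := Nat.le_ceil _
  have h2 : Y / Z ≤ ρ ^ K := by
    have h3 : Real.log (Y / Z) ≤ Real.log (ρ ^ K) := by
      rw [Real.log_pow]; rwa [div_le_iff₀ hlog] at h1
    exact (Real.log_le_log_iff (by positivity) (by positivity)).1 h3
  unfold geomSeq
  rw [div_le_iff₀ (by positivity)]
  rw [div_le_iff₀ hZ] at h2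
  linarith

/-- With `K = ⌈log(Y/Z)/log ρ⌉₊` and `Z ≤ Y`: `y_K > Z/ρ`. [folklore] -/
theorem geomSeq_ceilLog_gt {Y Z ρ : ℝ} (hZ : 0 < Z) (hYZ : Z ≤ Y) (hρ : 1 < ρ) :
    Z / ρ < geomSeq Y ρ ⌈Real.log (Y / Z) / Real.log ρ⌉₊ := by
  have hρ0 : 0 < ρ := by linarith
  have hY0 : 0 < Y := hZ.trans_le hYZ
  have hlog : 0 < Real.log ρ := Real.log_pos hρ
  have hYZ0 : 0 ≤ Real.log (Y / Z) / Real.log ρ :=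
    div_nonneg (Real.log_nonneg (by rw [le_div_iff₀ hZ]; linarith)) hlog.le
  set K := ⌈Real.log (Y / Z) / Real.log ρ⌉₊ with hK
  have h1 : (K : ℝ) < Real.log (Y / Z) / Real.log ρ + 1 := Nat.ceil_lt_add_one hYZ0
  have h1' : ((K : ℝ) - 1) * Real.log ρ < Real.log (Y / Z) := by
    rw [← lt_div_iff₀ hlog]; linarith
  have h2 : ρ ^ K < ρ * (Y / Z) := by
    have h3 : Real.log (ρ ^ K) < Real.log (ρ * (Y / Z)) := by
      rw [Real.log_pow, Real.log_mul hρ0.ne' (by positivity)]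
      nlinarith
    exact (Real.log_lt_log_iff (by positivity) (by positivity)).1 h3
  have h4 : Z * ρ ^ K < ρ * Y := by
    calc Z * ρ ^ K < Z * (ρ * (Y / Z)) := mul_lt_mul_of_pos_left h2 hZ
      _ = ρ * Y := by field_simp
  unfold geomSeq
  rw [div_lt_div_iff₀ hρ0 (by positivity)]
  linarith

end VdC
end Literature.NumberTheory.LFunctions
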